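import Mathlib
import HarnessLib
import Summits.HubbardSuperconductivity.HubbardSuperconductivity.Theorems.KLProgrammeKLRegimeSplitTwoLegSizesMSOfPieces

/-!
# Route `KLProgramme`, crux K3 — gen-5 ENGINE child (stmt-…-19918, `stub_twoLeg_scale0`, clause `TwoLegSizesMST`), recipe (L)+(F):
# (E3a-MS) AT SCALE `0` KEYED BY THE ADMISSIBLE PIECES (the base case of `…MSOfPieces`)

Seat hubbard-kl-k3c3-p1 (g3).  The scale-`0` piece is `E(S₀^K∘k_F^K − K∘k_F^K)` (`klTwoLegPieceFn_eval_zero`); with the chain based at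
`n₀ = 0` (base frame `Kp 0 ⊕ constants ⊕ low parts`, slots `m ∈ Ioc 0 (nScales β)`) and a symbol family `S k` riding the chain whose LAST
member reads the scale-`0` profile (`klLocalPart 0 − K∘k_F^K = (S (nScales β)) ∘ k_F^K`; the consumer takes `S k = S₀[msChain k] − msChain k`),
the three theorems of `…MSOfChainF` / `…MSOfTableF` / `…MSOfPieces` hold verbatim at scale `0`:
`twoLegSizesMST_zero_of_chainF_sizes`, `twoLegSizesMST_zero_of_chainF_table`, `twoLegSizesMST_zero_of_pieces`.  Proofs only.
-/

noncomputable section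

namespace Summit.HubbardSuperconductivity.HubbardSuperconductivity.Theorems.KLRegimeSplit

set_option linter.dupNamespace false -- summit = problem name (single-conjunct summit), D-0017
set_option maxSynthPendingDepth 4 -- nested operator-norm instances (symbol sizes up to order five), as in `…CompDiff`

open Real Finset Literature.MathematicalPhysics.QuantumLattice Literature.MathematicalPhysics.QuantumLattice.FermiRG
open Literature.MathematicalPhysics.QuantumLattice.BandSectorCounting
open Summit.HubbardSuperconductivity.HubbardSuperconductivity.Theorems.KLProgrammeLegKernels
open Summit.HubbardSuperconductivity.HubbardSuperconductivity.Theorems.DispersionFlow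
open Summit.HubbardSuperconductivity.HubbardSuperconductivity.Theorems.PerturbedFermiCurve

section MS

variable {L M : ℕ} [NeZero L] [NeZero M] {G : GeoConsts} {Q : EngConsts} {R : RenConsts} {β U μ : ℝ}

/-- **(E3a-MS) AT SCALE `0` FROM THE CHAIN-FAMILY PROFILES' ANGULAR SIZES.** -/
theorem twoLegSizesMST_zero_of_chainF_sizes (hμ : μ ∈ klWindowC) {K : TrigPolyC4v} {Kp : ℕ → TrigPolyC4v}
    (hK : ∀ p : Fin 2 → ℝ, K.eval p = ∑ m ∈ range (nScales β + 1), (Kp m).eval p) (d : ℕ)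
    (hc₀ : Continuous (klLocalPart L M β U μ K 0))
    {S : ℕ → TrigPolyC4v}
    (hS : ∀ θ, klLocalPart L M β U μ K 0 θ - K.eval (klFermiPoint μ K θ) = (S (nScales β)).eval (klFermiPoint μ K θ))
    (hC : ∀ k ≤ nScales β, ContDiff ℝ 4 (klFermiPoint μ (msChain d Kp 0 (nScales β) k)))
    {X : ℝ} (hX : ∀ l ≤ 4, ∀ x : ℝ, ‖iteratedFDeriv ℝ l salmhoferCutoff x‖ ≤ X)
    (Gs : ℕ → ℕ → ℝ)
    (hGs : ∀ m, ∀ j ≤ 4, ∀ i ≤ j, ∀ t : ℝ,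
      ‖iteratedFDeriv ℝ i (fun t => msProfileF μ S d Kp 0 (nScales β) m t -
        klAngularMean (msProfileF μ S d Kp 0 (nScales β) m)) t‖ ≤ Gs m j)
    (hfit_n : ∀ j ≤ 4, (if j = 0 then |klAngularMean (msProfileF μ S d Kp 0 (nScales β) 0)| else 0) +
      (j.factorial : ℝ) ^ 2 * (2 * j.factorial * X * 200 ^ j) * Gs 0 j * (4 + max 1 (((j - 1).factorial : ℝ) / (8 / 5))) ^ j ≤
        twoLegBar G Q U j 0)
    (hfit_m : ∀ m ∈ Ioc 0 (nScales β), ∀ j ≤ 4,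
      (if j = 0 then |klAngularMean (msProfileF μ S d Kp 0 (nScales β) m)| else 0) +
      (j.factorial : ℝ) ^ 2 * (2 * j.factorial * X * 200 ^ j) * Gs m j * (4 + max 1 (((j - 1).factorial : ℝ) / (8 / 5))) ^ j ≤
        msBar G Q U 0 * (R.Gfr j * uPow j U * (4 : ℝ) ^ (((j : ℤ) - 2) * m))) :
    TwoLegSizesMST L M G Q R β U μ K 0 := by
  have hlast : klFermiPoint μ (msChain d Kp 0 (nScales β) (nScales β - 0)) = klFermiPoint μ K :=
    klFermiPoint_msChain_last d hK (Nat.zero_le _) μ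
  have hcK : Continuous fun θ => K.eval (klFermiPoint μ K θ) := by
    have h := (TrigPolyC4v.contDiff_eval K (n := 4)).continuous.comp (hC (nScales β - 0) (by omega)).continuous
    rw [hlast] at h; exact h
  have hδ : (fun θ => klLocalPart L M β U μ K 0 θ - K.eval (klFermiPoint μ K θ)) =
      curveProfile μ (S (nScales β - 0)) K := by
    funext θ; rw [hS θ, Nat.sub_zero]; rfl
  have hP : klTwoLegPieceFn L M β U μ K.eval 0 = klFrameExtFn μ (curveProfile μ (S (nScales β - 0)) K) := by
    rw [klTwoLegPieceFn_eval_zero β U μ K hc₀ hcK, hδ]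
  exact twoLegSizesMST_of_profile_split hμ hP (msProfileF μ S d Kp 0 (nScales β))
    (fun θ => msProfileF_split μ S d hK (Nat.zero_le _) θ)
    (contDiff_msProfileF μ S d Kp 0 (nScales β) (fun k hk => hC k (by omega)))
    (msProfileF_periodic μ S d Kp 0 (nScales β)) (msProfileF_even μ S d Kp 0 (nScales β))
    (msProfileF_diag μ S d Kp 0 (nScales β)) hX Gs hGs hfit_n hfit_m

/-- **(E3a-MS) AT SCALE `0` FROM THE CHAIN-FAMILY TERM TABLE.** -/
theorem twoLegSizesMST_zero_of_chainF_table (hμ : μ ∈ klWindowC) {K : TrigPolyC4v} {Kp : ℕ → TrigPolyC4v}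
    (hK : ∀ p : Fin 2 → ℝ, K.eval p = ∑ m ∈ range (nScales β + 1), (Kp m).eval p) (d : ℕ)
    (hc₀ : Continuous (klLocalPart L M β U μ K 0))
    {S : ℕ → TrigPolyC4v}
    (hS : ∀ θ, klLocalPart L M β U μ K 0 θ - K.eval (klFermiPoint μ K θ) = (S (nScales β)).eval (klFermiPoint μ K θ))
    {a : ℕ → ℕ → ℝ} (ha : ∀ m ≤ nScales β, ∀ j ≤ 4, ∀ q : Momentum, ‖iteratedFDeriv ℝ j (evalM (Kp m)) q‖ ≤ a m j)
    {A : ℝ} (hA : ∀ j ≤ 2, chainSizeSum Kp a 0 (nScales β) j ≤ A) (hA20 : A ≤ 1 / 20)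
    (hd : klCurveD ≤ (bandBounds (show (-4 : ℝ) < -1.1 by norm_num) (show (-1.1 : ℝ) ≤ -0.1 by norm_num)
      (show (-0.1 : ℝ) < 0 by norm_num)).Dtmin - 2 * A)
    (hlo : (-1.1 : ℝ) ≤ μ - A) (hhi : μ + A ≤ -0.1)
    {A₃ A₄ : ℝ} (hA₃ : chainSizeSum Kp a 0 (nScales β) 3 ≤ A₃) (hA₄ : chainSizeSum Kp a 0 (nScales β) 4 ≤ A₄)
    {σ : ℕ → ℕ → ℝ} (hσnn : ∀ k l, 0 ≤ σ k l)
    (hσ0 : ∀ k ≤ nScales β, ∀ q : Momentum, |evalM (S k) q| ≤ σ k 0)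
    (hσ : ∀ k ≤ nScales β, ∀ l, 1 ≤ l → l ≤ 5 → ∀ q : Momentum, ‖iteratedFDeriv ℝ l (evalM (S k)) q‖ ≤ σ k l)
    {ε : ℕ → ℕ → ℝ} (hεnn : ∀ m l, 0 ≤ ε m l)
    (hε0 : ∀ m ∈ Ioc 0 (nScales β), ∀ q : Momentum, |evalM (fsub (S m) (S (m - 1))) q| ≤ ε m 0)
    (hε : ∀ m ∈ Ioc 0 (nScales β), ∀ l, 1 ≤ l → l ≤ 4 → ∀ q : Momentum,
      ‖iteratedFDeriv ℝ l (evalM (fsub (S m) (S (m - 1)))) q‖ ≤ ε m l)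
    {e : ℕ → ℕ → ℝ}
    (he : ∀ m ∈ Ioc 0 (nScales β), ∀ j ≤ 4, ∀ q : Momentum, ‖iteratedFDeriv ℝ j (evalM (highPart d (Kp m))) q‖ ≤ e m j)
    {X : ℝ} (hX : ∀ l ≤ 4, ∀ x : ℝ, ‖iteratedFDeriv ℝ l salmhoferCutoff x‖ ≤ X)
    (hfit_n : ∀ j ≤ 4, (if j = 0 then σ 0 0 else 0) +
      (j.factorial : ℝ) ^ 2 * (2 * j.factorial * X * 200 ^ j) * bellCum (σ 0) (msD A₃ A₄) j *
        (4 + max 1 (((j - 1).factorial : ℝ) / (8 / 5))) ^ j ≤ twoLegBar G Q U j 0)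
    (hfit_m : ∀ m ∈ Ioc 0 (nScales β), ∀ j ≤ 4,
      (if j = 0 then ε m 0 + σ (m - 1) 1 * msdD A A₃ A₄ ((bandBounds (show (-4 : ℝ) < -1.1 by norm_num)
        (show (-1.1 : ℝ) ≤ -0.1 by norm_num) (show (-0.1 : ℝ) < 0 by norm_num)).Dtmin) (e m) 0 else 0) +
      (j.factorial : ℝ) ^ 2 * (2 * j.factorial * X * 200 ^ j) *
        (bellCum (ε m) (msD A₃ A₄) j + bellDiffCum (σ (m - 1)) (msD A₃ A₄)
          (msdD A A₃ A₄ ((bandBounds (show (-4 : ℝ) < -1.1 by norm_num) (show (-1.1 : ℝ) ≤ -0.1 by norm_num)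
            (show (-0.1 : ℝ) < 0 by norm_num)).Dtmin) (e m)) j) *
        (4 + max 1 (((j - 1).factorial : ℝ) / (8 / 5))) ^ j ≤
        msBar G Q U 0 * (R.Gfr j * uPow j U * (4 : ℝ) ^ (((j : ℤ) - 2) * m))) :
    TwoLegSizesMST L M G Q R β U μ K 0 := by
  set B := bandBounds (show (-4 : ℝ) < -1.1 by norm_num) (show (-1.1 : ℝ) ≤ -0.1 by norm_num) (show (-0.1 : ℝ) < 0 by norm_num)
    with hBdef
  have hn : 0 ≤ nScales β := Nat.zero_le _
  have hC : ∀ k ≤ nScales β, ContDiff ℝ 4 (klFermiPoint μ (msChain d Kp 0 (nScales β) k)) :=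
    fun k hk => (chain_curve_sizes d hn ha hA hA20 hd hlo hhi hA₃ hA₄ (k := k) (by omega) 0).2.1
  have hσ0' : ∀ k ≤ nScales β - 0, ∀ q : Momentum, |evalM (S k) q| ≤ σ k 0 := fun k hk => hσ0 k (by omega)
  have hσ' : ∀ k ≤ nScales β - 0, ∀ l, 1 ≤ l → l ≤ 5 → ∀ q : Momentum, ‖iteratedFDeriv ℝ l (evalM (S k)) q‖ ≤ σ k l :=
    fun k hk => hσ k (by omega)
  have hε0' : ∀ m ∈ Ioc 0 (nScales β), ∀ q : Momentum, |evalM (fsub (S (m - 0)) (S (m - 0 - 1))) q| ≤ ε m 0 := by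
    simpa only [Nat.sub_zero] using hε0
  have hε' : ∀ m ∈ Ioc 0 (nScales β), ∀ l, 1 ≤ l → l ≤ 4 → ∀ q : Momentum,
      ‖iteratedFDeriv ℝ l (evalM (fsub (S (m - 0)) (S (m - 0 - 1)))) q‖ ≤ ε m l := by
    simpa only [Nat.sub_zero] using hε
  have hGs := fun m j (hj : j ≤ 4) i (hi : i ≤ j) t =>
    msProfileF_centred_sizes d hn ha hA hA20 hd hlo hhi hA₃ hA₄ S hσnn hσ0' hσ' hεnn hε0' hε' he m hj hi t
  have hmean := abs_klAngularMean_msProfileF_le d hn ha hA hA20 hd hlo hhi hA₃ hA₄ S hσnn hσ0' hσ' hε0' he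
  refine twoLegSizesMST_zero_of_chainF_sizes hμ hK d hc₀ hS hC hX
    (fun m j => msGsF σ ε A A₃ A₄ B.Dtmin e 0 (nScales β) m j) hGs ?_ ?_
  · intro j hj
    refine le_trans ?_ (hfit_n j hj)
    have h1 : (if j = 0 then |klAngularMean (msProfileF μ S d Kp 0 (nScales β) 0)| else 0) ≤ (if j = 0 then σ 0 0 else 0) := by
      split_ifs
      · simpa [msMeanF] using hmean 0
      · exact le_rfl
    have h2 : msGsF σ ε A A₃ A₄ B.Dtmin e 0 (nScales β) 0 j = bellCum (σ 0) (msD A₃ A₄) j := by simp [msGsF]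
    rw [h2]
    linarith
  · intro m hm j hj
    refine le_trans ?_ (hfit_m m hm j hj)
    have hne : m ≠ 0 := by have := (Finset.mem_Ioc.mp hm).1; omega
    have h1 : (if j = 0 then |klAngularMean (msProfileF μ S d Kp 0 (nScales β) m)| else 0) ≤
        (if j = 0 then ε m 0 + σ (m - 1) 1 * msdD A A₃ A₄ B.Dtmin (e m) 0 else 0) := by
      split_ifs
      · simpa [msMeanF, hne, hm] using hmean m
      · exact le_rfl
    have h2 : msGsF σ ε A A₃ A₄ B.Dtmin e 0 (nScales β) m j =
        bellCum (ε m) (msD A₃ A₄) j + bellDiffCum (σ (m - 1)) (msD A₃ A₄) (msdD A A₃ A₄ B.Dtmin (e m)) j := by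
      simp [msGsF, hne, hm]
    rw [h2]
    linarith

/-- **(E3a-MS) AT SCALE `0` IN THE KL REGIME, KEYED BY THE ADMISSIBLE PIECES.** -/
theorem twoLegSizesMST_zero_of_pieces (hR : ∀ j, 0 ≤ R.Gfr j) {c : ℝ} (hc : 0 < c) (hcle : c ≤ klCurveC3 R / 16)
    (hU : 0 < U) (hUle : U ≤ klCurveU0 R / 16) (hβmin : klBetaMin ≤ β) (hβc : β ≤ Real.exp (c / U ^ 2)) (hμ : μ ∈ klWindowC)
    {K : TrigPolyC4v} {Kp : ℕ → TrigPolyC4v} (hK : ∀ p : Fin 2 → ℝ, K.eval p = ∑ m ∈ range (nScales β + 1), (Kp m).eval p)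
    (ha : ∀ m ≤ nScales β, ∀ j ≤ 4, ∀ q : Momentum, ‖iteratedFDeriv ℝ j (evalM (Kp m)) q‖ ≤ pieceSize R U m j)
    (d : ℕ) (hc₀ : Continuous (klLocalPart L M β U μ K 0))
    {S : ℕ → TrigPolyC4v}
    (hS : ∀ θ, klLocalPart L M β U μ K 0 θ - K.eval (klFermiPoint μ K θ) = (S (nScales β)).eval (klFermiPoint μ K θ))
    {σ : ℕ → ℕ → ℝ} (hσnn : ∀ k l, 0 ≤ σ k l)
    (hσ0 : ∀ k ≤ nScales β, ∀ q : Momentum, |evalM (S k) q| ≤ σ k 0)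
    (hσ : ∀ k ≤ nScales β, ∀ l, 1 ≤ l → l ≤ 5 → ∀ q : Momentum, ‖iteratedFDeriv ℝ l (evalM (S k)) q‖ ≤ σ k l)
    {ε : ℕ → ℕ → ℝ} (hεnn : ∀ m l, 0 ≤ ε m l)
    (hε0 : ∀ m ∈ Ioc 0 (nScales β), ∀ q : Momentum, |evalM (fsub (S m) (S (m - 1))) q| ≤ ε m 0)
    (hε : ∀ m ∈ Ioc 0 (nScales β), ∀ l, 1 ≤ l → l ≤ 4 → ∀ q : Momentum,
      ‖iteratedFDeriv ℝ l (evalM (fsub (S m) (S (m - 1)))) q‖ ≤ ε m l)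
    {X : ℝ} (hX : ∀ l ≤ 4, ∀ x : ℝ, ‖iteratedFDeriv ℝ l salmhoferCutoff x‖ ≤ X)
    (hfit_n : ∀ j ≤ 4, (if j = 0 then σ 0 0 else 0) +
      (j.factorial : ℝ) ^ 2 * (2 * j.factorial * X * 200 ^ j) *
        bellCum (σ 0) (msD (msA3 R U (nScales β)) (msA4 R U (nScales β))) j *
        (4 + max 1 (((j - 1).factorial : ℝ) / (8 / 5))) ^ j ≤ twoLegBar G Q U j 0)
    (hfit_m : ∀ m ∈ Ioc 0 (nScales β), ∀ j ≤ 4,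
      (if j = 0 then ε m 0 + σ (m - 1) 1 *
        msdD (msA R c U) (msA3 R U (nScales β)) (msA4 R U (nScales β)) ((bandBounds (show (-4 : ℝ) < -1.1 by norm_num)
          (show (-1.1 : ℝ) ≤ -0.1 by norm_num) (show (-0.1 : ℝ) < 0 by norm_num)).Dtmin) (msE d (pieceSize R U m)) 0 else 0) +
      (j.factorial : ℝ) ^ 2 * (2 * j.factorial * X * 200 ^ j) *
        (bellCum (ε m) (msD (msA3 R U (nScales β)) (msA4 R U (nScales β))) j +
          bellDiffCum (σ (m - 1)) (msD (msA3 R U (nScales β)) (msA4 R U (nScales β)))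
            (msdD (msA R c U) (msA3 R U (nScales β)) (msA4 R U (nScales β)) ((bandBounds (show (-4 : ℝ) < -1.1 by norm_num)
              (show (-1.1 : ℝ) ≤ -0.1 by norm_num) (show (-0.1 : ℝ) < 0 by norm_num)).Dtmin) (msE d (pieceSize R U m))) j) *
        (4 + max 1 (((j - 1).factorial : ℝ) / (8 / 5))) ^ j ≤
        msBar G Q U 0 * (R.Gfr j * uPow j U * (4 : ℝ) ^ (((j : ℤ) - 2) * m))) :
    TwoLegSizesMST L M G Q R β U μ K 0 := by
  obtain ⟨hA, hA20, hd, ⟨hlo, hhi⟩, hA₃, hA₄⟩ :=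
    chain_regime_of_pieces hR hc hcle hU hUle hβmin hβc hμ ha (n := 0) (Nat.zero_le _)
  have he : ∀ m ∈ Ioc 0 (nScales β), ∀ j ≤ 4, ∀ q : Momentum,
      ‖iteratedFDeriv ℝ j (evalM (highPart d (Kp m))) q‖ ≤ msE d (pieceSize R U m) j :=
    fun m hm j hj q => norm_iteratedFDeriv_evalM_highPart_le_msE d (ha m (Finset.mem_Ioc.mp hm).2) hj q
  exact twoLegSizesMST_zero_of_chainF_table hμ hK d hc₀ hS ha hA hA20 hd hlo hhi hA₃ hA₄ hσnn hσ0 hσ hεnn hε0 hε he hX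
    hfit_n hfit_m

end MS

end Summit.HubbardSuperconductivity.HubbardSuperconductivity.Theorems.KLRegimeSplit

end
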